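import Summits.BirchSwinnertonDyer.BirchSwinnertonDyer.Theorems.ResidualThetaTransportAtTwoThetaLayerLambdaCongruenceAtTwoCuspSpanTriangle
import Summits.BirchSwinnertonDyer.BirchSwinnertonDyer.Theorems.ResidualThetaTransportAtTwoThetaLayerLambdaCongruenceAtTwoCuspSpanHenselFour
import HarnessLib

/-!
# Route `ResidualThetaTransportAtTwo`, node 27436 (cruxes Kan⁺ stmt-BirchSwinnertonDyer-20688 / Kμ⁺ 20689 / 21437): tools for the
# `q`-adic triangles at PRIME-POWER level — the level-`N` triangle lemma, the quadratic `K`-seed, the Hensel period, and the node at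
# every power of `3`

Cell `bsd-wall`, width seat `bsd-wall-rtt-p3-w2` g4 (2026-08-28). THEOREMS ONLY; `--supports stmt-BirchSwinnertonDyer-20688`; BSD is not
proved by this. Sequel to `…CuspSpanTriangle` / `…CuspSpanHenselFour` / `…CuspSpanPrimeLevel` (node at every prime).

* §1 `chi_eq_of_apply_one_one_dvd_sub_four_pow_of_cast_pow_eq_one` — the triangle lemma at ANY level `N`: if `g = (a b; c d) ∈ Γ₀(N)`,
  `d ∣ c − 4^k` and `4^k ≡ 1 (mod N)`, then `χ g = F(d̄)` (no 4-invariance needed: `d δ₃ ≡ −1`, the `S`-rule). Three-term form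
  `chi_add_chi_eq_of_triangle_of_cast_pow_eq_one`.
* §2 `chi_eq_zero_of_b_neg_one_of_quadratic` — `K(d̄)` whenever `N ∣ d² + td + 1` with `|t| ≤ 2` (the element `(−d−t, −1; d²+td+1, d)` has
  trace `−t`): covers the lower-right entries of ALL small-trace elements at any level (at prime-power level `(d̄ ∓ 1)² = 0` does not force
  `d̄ = ±1`).
* §3 `prime_pow_dvd_four_pow_half_mul_sub_one` — `q^{j+1} ∣ 4^{((q−1)/2) q^j} − 1` (the odd period of `4` modulo `q^{j+1}` for `q ≡ 3 (4)`).
* §4 `units_three_pow_eq_pm_four_pow` — `(ℤ/3^t)ˣ = ±⟨4⟩` for every `t ≥ 1` (Hensel, `e = 1`), hence **`cuspSpanEvenAtTwo_three_pow`: the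
  node at every level `3^t`** by the lead's Theorem A (`cuspSpanEvenAtTwo_of_primePow`).

References: [Rademacher1929] §1; [Knapp1993] Prop. 11.1; [Pollack2003] Conj. 6.3.
-/

set_option autoImplicit false
set_option linter.dupNamespace false

open scoped MatrixGroups

open CongruenceSubgroup

namespace Summit.BirchSwinnertonDyer.BirchSwinnertonDyer.Theorems.SignedMuAtTwo

/-! ## §1. The triangle lemma at any level -/

section AnyLevel

variable {N : ℕ} {χ : Gamma0 N → ZMod 2}

/-- **Triangle lemma, any level.** For `g = (a b; c d) ∈ Γ₀(N)` with `d ∣ c − 4^k` and `4^k ≡ 1 (mod N)`: `χ g = χ β` for every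
`b = −1` element `β` with `d(β) ≡ d (mod N)`. With `δ₃ := (c − 4^k)/d` one has `(−d)δ₃ + (c' − m)N = 1` (`c = Nc'`, `4^k = 1 + Nm`), the
element `β₃ = (−d, −1; N(c'−m), δ₃)` gives `(gβ₃)₁₁ = −4^k`, and `d δ₃ ≡ −1`. [cite: Rademacher1929, §1] -/
theorem chi_eq_of_apply_one_one_dvd_sub_four_pow_of_cast_pow_eq_one
    (hadd : ∀ γ δ : Gamma0 N, χ (γ * δ) = χ γ + χ δ)
    (hsmall : ∀ γ : Gamma0 N, ((γ : SL(2, ℤ)) 0 0 + (γ : SL(2, ℤ)) 1 1).natAbs ≤ 2 → χ γ = 0)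
    (hkill : ∀ γ : Gamma0 N, (∃ k : ℕ, 1 ≤ k ∧ ((γ : SL(2, ℤ)) 1 1).natAbs = 4 ^ k) → χ γ = 0)
    (g : Gamma0 N) (k : ℕ) (hk : 1 ≤ k) (h4 : (N : ℤ) ∣ 4 ^ k - 1)
    (hdvd : (g : SL(2, ℤ)) 1 1 ∣ (g : SL(2, ℤ)) 1 0 - 4 ^ k)
    {β : Gamma0 N} (hb : (β : SL(2, ℤ)) 0 1 = -1)
    (hd : ((((β : SL(2, ℤ)) 1 1 : ℤ) : ZMod N)) = ((((g : SL(2, ℤ)) 1 1 : ℤ) : ZMod N))) : χ g = χ β := by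
  set c : ℤ := (g : SL(2, ℤ)) 1 0 with hc
  set d : ℤ := (g : SL(2, ℤ)) 1 1 with hdd
  obtain ⟨δ₃, hδ⟩ := hdvd
  obtain ⟨m, hm⟩ := h4
  have hcN : (N : ℤ) ∣ c := by
    have hmem := g.2
    rw [Gamma0_mem] at hmem
    exact (ZMod.intCast_zmod_eq_zero_iff_dvd _ N).mp hmem
  obtain ⟨c', hc'⟩ := hcN
  -- explicit Bezout: `(−d) δ₃ − (−1)·N(c' − m) = 1`
  obtain ⟨β₃, -, h301, -, h311⟩ := ThetaLayerLambdaCongruenceAtTwo.exists_gamma0_entries (N := N)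
    (-d) (-1) (N * (c' - m)) δ₃ (by linear_combination hδ - hc' + hm) (dvd_mul_right _ _)
  have hprod : ((g * β₃ : Gamma0 N) : SL(2, ℤ)) 1 1 = -4 ^ k := by
    rw [gamma0_mul_apply_one_one', h301, h311]; linear_combination (-1 : ℤ) * hδ
  have hkilled : χ (g * β₃) = 0 :=
    hkill _ ⟨k, hk, by rw [hprod, Int.natAbs_neg, Int.natAbs_pow]; rfl⟩
  have hg3 : χ g = χ β₃ := by
    rw [hadd] at hkilled
    have e1 : χ g = -χ β₃ := by linear_combination hkilled
    rw [e1, ZMod.neg_eq_self_mod_two]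
  have hres : ((((β₃ : SL(2, ℤ)) 1 1 : ℤ) : ZMod N)) * ((((β : SL(2, ℤ)) 1 1 : ℤ) : ZMod N)) = -1 := by
    rw [h311, hd]
    have e1 : δ₃ * d = -1 + (N : ℤ) * (c' - m) := by linear_combination -hδ + hc' - hm
    have e2 := congrArg (Int.cast : ℤ → ZMod N) e1
    push_cast at e2
    rw [ZMod.natCast_self, zero_mul, add_zero] at e2
    exact e2
  rw [hg3, chi_eq_of_b_neg_one_of_mul_d_eq_neg_one hadd hsmall h301 hb hres]

/-- **Triangle identity, any level.** For `b = −1` elements `g, β'` of `Γ₀(N)` whose product satisfies `(gβ')₁₁ ∣ (gβ')₁₀ − 4^k` with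
`4^k ≡ 1 (mod N)`, and any `b = −1` element `β₃` with `d(β₃) ≡ (gβ')₁₁`: `χ g + χ β' = χ β₃`. [cite: Rademacher1929, §1] -/
theorem chi_add_chi_eq_of_triangle_of_cast_pow_eq_one
    (hadd : ∀ γ δ : Gamma0 N, χ (γ * δ) = χ γ + χ δ)
    (hsmall : ∀ γ : Gamma0 N, ((γ : SL(2, ℤ)) 0 0 + (γ : SL(2, ℤ)) 1 1).natAbs ≤ 2 → χ γ = 0)
    (hkill : ∀ γ : Gamma0 N, (∃ k : ℕ, 1 ≤ k ∧ ((γ : SL(2, ℤ)) 1 1).natAbs = 4 ^ k) → χ γ = 0)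
    (g β' : Gamma0 N) (k : ℕ) (hk : 1 ≤ k) (h4 : (N : ℤ) ∣ 4 ^ k - 1)
    (hdvd : ((g * β' : Gamma0 N) : SL(2, ℤ)) 1 1 ∣ ((g * β' : Gamma0 N) : SL(2, ℤ)) 1 0 - 4 ^ k)
    {β₃ : Gamma0 N} (hb₃ : (β₃ : SL(2, ℤ)) 0 1 = -1)
    (hd₃ : ((((β₃ : SL(2, ℤ)) 1 1 : ℤ) : ZMod N)) = ((((g * β' : Gamma0 N) : SL(2, ℤ)) 1 1 : ℤ) : ZMod N)) :
    χ g + χ β' = χ β₃ := by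
  rw [← hadd]
  exact chi_eq_of_apply_one_one_dvd_sub_four_pow_of_cast_pow_eq_one hadd hsmall hkill (g * β') k hk h4 hdvd hb₃ hd₃

/-! ## §2. The quadratic `K`-seed (parabolic and elliptic lower-right entries) -/

/-- **`K(d̄)` for `N ∣ d² + td + 1`, `|t| ≤ 2`**: the element `(−d − t, −1; d² + td + 1, d) ∈ Γ₀(N)` has trace `−t`. Covers the
elliptic residues (`|t| ≤ 1`, `…GenerationB1.chi_eq_zero_of_b_neg_one_of_elliptic`) and the PARABOLIC ones (`t = ±2`, `(d ± 1)² ≡ 0`),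
which at prime-power level are not only `±1`. [cite: Knapp1993, Prop. 11.1] -/
theorem chi_eq_zero_of_b_neg_one_of_quadratic
    (hadd : ∀ γ δ : Gamma0 N, χ (γ * δ) = χ γ + χ δ)
    (hsmall : ∀ γ : Gamma0 N, ((γ : SL(2, ℤ)) 0 0 + (γ : SL(2, ℤ)) 1 1).natAbs ≤ 2 → χ γ = 0)
    (β : Gamma0 N) (hb : (β : SL(2, ℤ)) 0 1 = -1) (d t : ℤ) (ht : t.natAbs ≤ 2) (hN : (N : ℤ) ∣ d * d + t * d + 1)
    (hd : (((β : SL(2, ℤ)) 1 1 : ℤ) : ZMod N) = ((d : ℤ) : ZMod N)) : χ β = 0 := by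
  obtain ⟨e, he00, he01, he10, he11⟩ :=
    ThetaLayerLambdaCongruenceAtTwo.exists_gamma0_entries (N := N) (-d - t) (-1) (d * d + t * d + 1) d (by ring) hN
  have he : χ e = 0 := hsmall e (by rw [he00, he11]; ring_nf; omega)
  rw [chi_eq_of_apply_zero_one_eq_neg_one hadd hsmall hb he01 (by rw [hd, he11]), he]

/-- The lower-right entry `d` of a small-trace element of `Γ₀(N)` satisfies `N ∣ d² − (tr)d + 1`; hence `K(d̄)`: `χ` kills every
`b = −1` element with the same `d mod N`. [cite: Knapp1993, Prop. 11.1] -/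
theorem chi_eq_zero_of_b_neg_one_of_small_trace
    (hadd : ∀ γ δ : Gamma0 N, χ (γ * δ) = χ γ + χ δ)
    (hsmall : ∀ γ : Gamma0 N, ((γ : SL(2, ℤ)) 0 0 + (γ : SL(2, ℤ)) 1 1).natAbs ≤ 2 → χ γ = 0)
    (γ : Gamma0 N) (hγ : ((γ : SL(2, ℤ)) 0 0 + (γ : SL(2, ℤ)) 1 1).natAbs ≤ 2)
    (β : Gamma0 N) (hb : (β : SL(2, ℤ)) 0 1 = -1)
    (hd : (((β : SL(2, ℤ)) 1 1 : ℤ) : ZMod N) = ((((γ : SL(2, ℤ)) 1 1 : ℤ) : ZMod N))) : χ β = 0 := by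
  set a : ℤ := (γ : SL(2, ℤ)) 0 0 with ha
  set d : ℤ := (γ : SL(2, ℤ)) 1 1 with hdd
  have hdet := Matrix.SpecialLinearGroup.det_coe (γ : SL(2, ℤ))
  rw [Matrix.det_fin_two] at hdet
  have hcN : (N : ℤ) ∣ (γ : SL(2, ℤ)) 1 0 := by
    have hmem := γ.2
    rw [Gamma0_mem] at hmem
    exact (ZMod.intCast_zmod_eq_zero_iff_dvd _ N).mp hmem
  obtain ⟨c', hc'⟩ := hcN
  refine chi_eq_zero_of_b_neg_one_of_quadratic hadd hsmall β hb d (-(a + d)) (by rwa [Int.natAbs_neg]) ?_ hd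
  -- `d² − (a+d)d + 1 = 1 − ad = −bc = −b c' N`
  refine ⟨-((γ : SL(2, ℤ)) 0 1) * c', ?_⟩
  rw [ha, hdd] at *
  linear_combination -hdet + (-(γ : SL(2, ℤ)) 0 1) * hc'

end AnyLevel

/-! ## §3. The odd period of `4` modulo `q^{j+1}` -/

/-- For an odd prime `q` and every `j`: `q^{j+1} ∣ 4^{((q−1)/2)·q^j} − 1` (`4^{(q−1)/2} = 2^{q−1} ≡ 1`, then `q`-th powers).
[folklore] -/
theorem prime_pow_dvd_four_pow_half_mul_sub_one (q : ℕ) (hq : q.Prime) (hq2 : q ≠ 2) (j : ℕ) :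
    (q : ℤ) ^ (j + 1) ∣ 4 ^ ((q / 2) * q ^ j) - 1 := by
  haveI : Fact q.Prime := ⟨hq⟩
  induction j with
  | zero =>
    rw [pow_zero, mul_one, zero_add, pow_one, ← ZMod.intCast_zmod_eq_zero_iff_dvd]
    push_cast
    have h2 : (2 : ZMod q) ≠ 0 := by
      intro h0
      have h0' : ((2 : ℕ) : ZMod q) = 0 := by exact_mod_cast h0
      have := Nat.le_of_dvd (by norm_num) ((ZMod.natCast_eq_zero_iff 2 q).mp h0')
      have := hq.two_le; omega
    have hodd : q % 2 = 1 := Nat.odd_iff.mp (hq.eq_two_or_odd'.resolve_left hq2)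
    rw [show (4 : ZMod q) = 2 ^ 2 by norm_num, ← pow_mul, show 2 * (q / 2) = q - 1 by omega,
      ZMod.pow_card_sub_one_eq_one h2, sub_self]
  | succ j ih =>
    obtain ⟨c, hc⟩ := ih
    have hx : (4 : ℤ) ^ ((q / 2) * q ^ j) = 1 + (q : ℤ) ^ (j + 1) * c := by linear_combination hc
    obtain ⟨R, hR⟩ := exists_one_add_pow_eq_second_order ((q : ℤ) ^ (j + 1) * c) q
    refine ⟨c + (q : ℤ) ^ j * c ^ 2 * R, ?_⟩
    rw [pow_succ, ← mul_assoc, pow_mul, hx, hR]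
    ring

/-! ## §4. Every unit of `ℤ/3^t` is `±4^k`; the node at every power of `3` -/

/-- **`(ℤ/3^t)ˣ = ±⟨4⟩`** for every `t ≥ 1`: every unit of `ZMod (3^t)` is `4^k` or `−4^k` with `k ≥ 1` (Hensel with `e = 1`:
`v₃(4² − 1) = 1`). [folklore] -/
theorem units_three_pow_eq_pm_four_pow (t : ℕ) (ht : 1 ≤ t) :
    ∀ u : ZMod (3 ^ t), IsUnit u → ∃ k : ℕ, 1 ≤ k ∧ (u = (4 : ZMod (3 ^ t)) ^ k ∨ u = -(4 : ZMod (3 ^ t)) ^ k) := by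
  obtain ⟨e, he1, he3, hens⟩ := exists_hensel_four 3 Nat.prime_three (by norm_num)
  -- `e = 1` since `3^e ∣ 15`
  have he : e = 1 := by
    have h15 : (3 : ℤ) ^ e ∣ 15 := by norm_num at he3; exact he3
    by_contra hne
    have h2 : 2 ≤ e := by omega
    have h9 : (3 : ℤ) ^ 2 ∣ 15 := (pow_dvd_pow (3 : ℤ) h2).trans h15
    norm_num at h9
  subst he
  intro u hu
  have hmin : min 1 t = 1 := min_eq_left ht
  have hcop : Nat.Coprime u.val (3 ^ t) := by
    rw [← ZMod.natCast_zmod_val u, ZMod.isUnit_iff_coprime] at hu; exact hu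
  have hcop3 : Nat.Coprime u.val 3 := (Nat.coprime_pow_right_iff ht _ _).mp hcop
  have h3u : ¬ 3 ∣ u.val := fun h ↦ by
    have : Nat.gcd u.val 3 = 3 := Nat.gcd_eq_right h
    rw [hcop3] at this; norm_num at this
  have hcast : (((u.val : ℕ) : ℤ) : ZMod (3 ^ t)) = u := by
    rw [Int.cast_natCast, ZMod.natCast_zmod_val]
  have h3t : (((3 ^ t : ℕ) : ℤ)) = (3 : ℤ) ^ t := by push_cast; ring
  have hmod : u.val % 3 = 1 ∨ u.val % 3 = 2 := by omega
  rcases hmod with h1 | h2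
  · -- `u ≡ 1 (mod 3)`: `u = 4^k`
    have hx : (3 : ℤ) ^ (min 1 t) ∣ (u.val : ℤ) - 1 := by rw [hmin, pow_one]; omega
    obtain ⟨k, hk, hdvd⟩ := hens t (u.val : ℤ) hx
    refine ⟨k, hk, Or.inl ?_⟩
    have h0 : (((4 : ℤ) ^ k - (u.val : ℤ) : ℤ) : ZMod (3 ^ t)) = 0 := by
      rw [ZMod.intCast_zmod_eq_zero_iff_dvd, h3t]; exact hdvd
    push_cast at h0
    rw [ZMod.natCast_zmod_val] at h0
    linear_combination -h0
  · -- `u ≡ 2 (mod 3)`: `u = −4^k`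
    have hx : (3 : ℤ) ^ (min 1 t) ∣ (-(u.val : ℤ)) - 1 := by rw [hmin, pow_one]; omega
    obtain ⟨k, hk, hdvd⟩ := hens t (-(u.val : ℤ)) hx
    refine ⟨k, hk, Or.inr ?_⟩
    have h0 : (((4 : ℤ) ^ k - (-(u.val : ℤ)) : ℤ) : ZMod (3 ^ t)) = 0 := by
      rw [ZMod.intCast_zmod_eq_zero_iff_dvd, h3t]; exact hdvd
    push_cast at h0
    rw [ZMod.natCast_zmod_val] at h0
    linear_combination h0

/-- **The node at every power of `3`: `CuspSpanEvenAtTwo (3^t)`, `t ≥ 1`** (`(ℤ/3^t)ˣ = ±⟨4⟩` + the lead's Theorem A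
`cuspSpanEvenAtTwo_of_primePow`). [cite: Pollack2003, Conj. 6.3] [cite: Rademacher1929, §1] -/
theorem cuspSpanEvenAtTwo_three_pow (t : ℕ) (ht : 1 ≤ t) : CuspSpanEvenAtTwo (3 ^ t) :=
  cuspSpanEvenAtTwo_of_primePow Nat.prime_three (units_three_pow_eq_pm_four_pow t ht)

end Summit.BirchSwinnertonDyer.BirchSwinnertonDyer.Theorems.SignedMuAtTwo
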